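import Summits.AtomisticToContinuum.Crystallization.Theorems.OverbindingBudgetBalancedCensusCones
import Summits.AtomisticToContinuum.Crystallization.Theorems.OverbindingBudgetShellHoleCover

/-!
# OverbindingBudget — the misfit census BALANCED against the chunk's own stress, IV: the record cones on the FIVE-slot line
# (decomp-a2c lens-4, generation 40)

Helper file (`--supports stmt-AtomisticToContinuum-31280`).  Since lens-3 (g28) proved `GapFreeShells` outright
(`…ShellHoleCover.gapFreeShells_holds`), the leaf line of record is the FIVE-slot cone XLV
`…ShellHoleCone.rdef_of_ceg_shape_registered : ChargedEnergyGap → TwoShellShape (1/100) (3/50) (1/450) → RegisteredScaleGap (122/125) 0 4 (3/50) (1/450)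
→ CleanlessExcessT → CoherentResidual 10 → RobustDefectLimitWindows` and the cut of record is XLI-W′ `…ShellHoleCone.rdef_of_ceg_tameScale`
(`ChargedEnergyGap → TameScaleGap (122/125) 0 → CleanlessExcessT → CoherentResidual 10 → RobustDefectLimitWindows`).  This file discharges the
`GapFreeShells` slot of the balanced cones of part III by that theorem:

* **CUT XLI-B′** `rdef_of_ceg_tameBalancedScale : ChargedEnergyGap → TameBalancedScaleGap (122/125) 0 → CleanlessExcessT →
  CoherentResidual 10 → RobustDefectLimitWindows` — the cut of record with its census slot KERNEL-WEAKENED by the stress rebate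
  (`cutXLIB_slot_of_cut_slot`);
* **CONE XLVI** `rdef_of_ceg_shape_balancedDeep : 0 ≤ ρ → ChargedEnergyGap → TwoShellShape (1/100) ε g →
  TameBalancedDeepScaleGap (122/125) 0 ρ ε g → CleanlessExcessT → CoherentResidual 10 → RobustDefectLimitWindows` (every depth, every shape
  pair), its `∃ ρ` form, and the RECORD INSTANCE
  `rdef_of_ceg_shape_balancedDeep_record` (`ρ = 4`, `ε = 3/50`, `g = 1/450`): cone XLV with its one hard slot `RegisteredScaleGap (122/125) 0 4 (3/50)
  (1/450)` replaced by the KERNEL-WEAKER `TameBalancedDeepScaleGap (122/125) 0 4 (3/50) (1/450)` (`…BalancedCensusCones.coneXLV_of_coneXLIV_slot`),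
  nothing added.
-/

namespace Summit.AtomisticToContinuum.Crystallization.Theorems.OverbindingBudgetBalancedCensusRecord

open Summit.AtomisticToContinuum.Crystallization.Theses.OverbindingBudget (RobustDefectLimitWindows)
open Summit.AtomisticToContinuum.Crystallization.Theses.PricedLinkCensus (ChargedEnergyGap)
open Summit.AtomisticToContinuum.Crystallization.Theorems.OverbindingBudgetGradedBareness (CleanlessExcessT)
open Summit.AtomisticToContinuum.Crystallization.Theorems.OverbindingBudgetCoherentCut (CoherentResidual)
open Summit.AtomisticToContinuum.Crystallization.Theorems.OverbindingBudgetGrossMargin (GrossLiouvilleLaw)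
open Summit.AtomisticToContinuum.Crystallization.Theorems.OverbindingBudgetMisfitRegistration (RegisteredScaleGap)
open Summit.AtomisticToContinuum.Crystallization.Theorems.OverbindingBudgetTwoShellShape (TwoShellShape)
open Summit.AtomisticToContinuum.Crystallization.Theorems.OverbindingBudgetMisfitWindowStatements (TameScaleGap)
open Summit.AtomisticToContinuum.Crystallization.Theorems.OverbindingBudgetShellHoleCover (gapFreeShells_holds)
open Summit.AtomisticToContinuum.Crystallization.Theorems.OverbindingBudgetBalancedCensusStatements
open Summit.AtomisticToContinuum.Crystallization.Theorems.OverbindingBudgetBalancedCensusCones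

/-- `TameBalancedScaleGap a 0 → TameBalancedMisfitGap a 0`, the gap-free slot discharged by `gapFreeShells_holds`. [this file] -/
theorem tameBalancedMisfitGap_zero_of_tameBalancedScale {a : ℝ} (hS : TameBalancedScaleGap a 0) : TameBalancedMisfitGap a 0 :=
  tameBalancedMisfitGap_zero_of_scale_gapFree hS gapFreeShells_holds

/-- `TwoShellShape (1/100) ε g → TameBalancedDeepScaleGap a 0 ρ ε g → TameBalancedMisfitGap a 0` (`0 ≤ ρ`). [this file] -/
theorem tameBalancedMisfitGap_of_shape_deep {a ρ ε g : ℝ} (hρ : 0 ≤ ρ) (hT : TwoShellShape (1 / 100) ε g)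
    (hD : TameBalancedDeepScaleGap a 0 ρ ε g) : TameBalancedMisfitGap a 0 :=
  tameBalancedMisfitGap_of_shape_deep_gapFree hρ hT hD gapFreeShells_holds

/-- The balanced tame SCALE census at an admissible spacing gives the gross Liouville law. [this file] -/
theorem grossLiouvilleLaw_of_tameBalancedScale {a T₀ D : ℝ} (ha : 47 / 50 ≤ a) (ha1 : a ≤ 1) (h : TameBalancedScaleGap a 0) :
    GrossLiouvilleLaw T₀ D :=
  grossLiouvilleLaw_of_tameBalancedMisfitGap ha ha1 (tameBalancedMisfitGap_zero_of_tameBalancedScale h)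

/-- **CUT XLI-B′ (four slots)** — `ChargedEnergyGap → TameBalancedScaleGap (122/125) 0 → CleanlessExcessT → CoherentResidual 10 →
RobustDefectLimitWindows`: the cut of record XLI-W′ with its census slot kernel-weakened by the stress rebate. [this file] -/
theorem rdef_of_ceg_tameBalancedScale (hCEG : ChargedEnergyGap) (hS : TameBalancedScaleGap (122 / 125) 0) (hCE : CleanlessExcessT)
    (hRes : CoherentResidual 10) : RobustDefectLimitWindows :=
  rdef_of_ceg_tameBalancedScale_gapFree hCEG hS gapFreeShells_holds hCE hRes

/-- The new cut slot is implied by the old one: `TameScaleGap (122/125) 0 → TameBalancedScaleGap (122/125) 0`. [this file] -/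
theorem cutXLIB_slot_of_cut_slot (hS : TameScaleGap (122 / 125) 0) : TameBalancedScaleGap (122 / 125) 0 :=
  tameBalancedScaleGap_of_tameScaleGap hS

/-- **CONE XLVI (parametric, five slots)** — `ChargedEnergyGap → TwoShellShape (1/100) ε g → TameBalancedDeepScaleGap (122/125) 0 ρ ε g →
CleanlessExcessT → CoherentResidual 10 → RobustDefectLimitWindows` for every depth `ρ ≥ 0` and every shape pair `(ε, g)`. [this file] -/
theorem rdef_of_ceg_shape_balancedDeep {ρ ε g : ℝ} (hρ : 0 ≤ ρ) (hCEG : ChargedEnergyGap) (hT : TwoShellShape (1 / 100) ε g)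
    (hD : TameBalancedDeepScaleGap (122 / 125) 0 ρ ε g) (hCE : CleanlessExcessT) (hRes : CoherentResidual 10) : RobustDefectLimitWindows :=
  rdef_of_ceg_shape_balancedDeep_gapFree hρ hCEG hT hD gapFreeShells_holds hCE hRes

/-- Cone XLVI with the depth existentially quantified. [this file] -/
theorem rdef_of_ceg_shape_someDeep {ε g : ℝ} (hCEG : ChargedEnergyGap) (hT : TwoShellShape (1 / 100) ε g)
    (hD : ∃ ρ : ℝ, 0 ≤ ρ ∧ TameBalancedDeepScaleGap (122 / 125) 0 ρ ε g) (hCE : CleanlessExcessT) (hRes : CoherentResidual 10) :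
    RobustDefectLimitWindows :=
  rdef_of_ceg_shape_someDeep_gapFree hCEG hT hD gapFreeShells_holds hCE hRes

/-- **CONE XLVI — the record instance, FIVE slots** (`ρ = 4`, `ε = 3/50`, `g = 1/450`): `ChargedEnergyGap → TwoShellShape (1/100) (3/50) (1/450) →
TameBalancedDeepScaleGap (122/125) 0 4 (3/50) (1/450) → CleanlessExcessT → CoherentResidual 10 → RobustDefectLimitWindows` — cone XLV
(`…ShellHoleCone.rdef_of_ceg_shape_registered`) with its one hard slot replaced by a KERNEL-WEAKER one (`coneXLV_of_coneXLIV_slot`). [this file] -/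
theorem rdef_of_ceg_shape_balancedDeep_record (hCEG : ChargedEnergyGap) (hT : TwoShellShape (1 / 100) (3 / 50) (1 / 450))
    (hD : TameBalancedDeepScaleGap (122 / 125) 0 4 (3 / 50) (1 / 450)) (hCE : CleanlessExcessT) (hRes : CoherentResidual 10) :
    RobustDefectLimitWindows :=
  rdef_of_ceg_shape_balancedDeep (by norm_num) hCEG hT hD hCE hRes

end Summit.AtomisticToContinuum.Crystallization.Theorems.OverbindingBudgetBalancedCensusRecord
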